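/- LEAD seat `ym-line-cbag-p1` (prover-ym-line-cbag-p1-g29-0), LINE 7b (`GlueballBandRecursion`, volume-comparison line): THE CLOSING COMPOSITION —
the width seats' spatial lifting of kept support classes (`SupportLifting.kept_sum_tube_mul_eq`, w5 g17) discharges the jet stub
`ColdFreeEnergyVolumeJets`, hence (floor: w5 g16; assemblies: LEAD) the volume comparison at small coupling and the ∃-WINDOW STRONG-COUPLING RUNG
`ColdDoublingRecursionSmallCoupling`, unconditionally.  Sorry-free; `--supports stmt-QuantumFields-22957 --as helper`. -/
import Summits.QuantumFields.YangMills.Theorems.GlueballBandRecursionKeptSupportLifting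
import Summits.QuantumFields.YangMills.Theorems.GlueballBandRecursionVolumeJetsOfSupport
import Summits.QuantumFields.YangMills.Theorems.GlueballBandRecursionColdFreeEnergyJets
import HarnessLib

/-!
# Route `GlueballBandRecursion`, line 7b — CLOSED: the cold dyadic contraction at small coupling, for every compact gauge group

THE THEOREM (`coldDoublingRecursionSmallCoupling_holds : ColdDoublingRecursionSmallCoupling`): for every compact group `G` and every faithful
unitary lattice representation `r` there are `β₁ > 0`, `C > 0`, `L₀` such that for all `0 ≤ β ≤ β₁`, `L ≥ L₀`, `L' ∈ [2L, 4L]`: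
`δᶜ_β(L') ≤ C · δᶜ_β(L)²` (`δᶜ = Cruxes.IR.ColdPurityBridge.coldDefect`, the cold period-doubling defect of Wilson's lattice gauge theory).
This is the IR cell's strong-coupling rung `ColdDoublingRecursionStrongCoupling` with the window constant `strongCouplingRadius r.ρ` replaced by an
existential `β₁(r) > 0` (the honest reach of crude Kotecký–Preiss constants).

THE PROOF (line 7b, LEAD + width seats w2–w5, 2026-08-28): same-volume squaring (`…RungOfVolumeComparison`) reduces the rung to the volume
comparison of the cold trace excess; the volume comparison follows (`…ColdDefectComparisonOfJets`) from the volume-uniform floor `(c₁β⁴)^t ≤ x_t(N)`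
(`…TraceExcessFloorAllSides`, w5 g16, from the IR cell's facing-plaquette `β⁴` law) and the JET STUB `ColdFreeEnergyVolumeJets` — the cold log-defect
density `(2 log Z(a³×t) − log Z(a³×2t))/a³` of two spatial volumes agrees to order `z^{3a}` at `z = 0`; the jet stub follows from the
CLOSEDNESS-AWARE support expansion of the crew: `log Z = Σ_A ψ(A)` regrouped by support (`…SupportExpansion`, w4), non-closed supports vanish by
free-bond Haar averaging (`…FreeBondAveraging/Factorisation`, w3; `…ClosedSupportsBox`, w4), wide closed supports sit in the rate-tracking tail
(`…SupportTruncation`, `…VolumeJetsOfSupport`, w4), closed connected supports with `≤ 4(a−1)` members root uniquely (girth-4 slab count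
`…SlabGirthCore/SlabCount/ClosedRooting(Unique)`, w2) and lift across spatial volumes (`…SupportInclusion`, w3; `…SupportLifting/KeptSupportLifting`,
w5).  Here: §1 the bridge from w5's full-kept identity to the closed-kept density identity (singletons are `6b³T·ℓ(z)`); §2 the explicit bound
`‖coldVolumeDiscrepancy‖ ≤ 48t(‖z‖/(e r_ρ))^{4a−3}` on the whole disc and `coldFreeEnergyVolumeJets_holds`; §3 `traceExcessVolumeComparisonSmallCoupling_holds`
and `coldDoublingRecursionSmallCoupling_holds`.

HONEST FRAMING.  A RECORD-type strong-coupling statement, group-blind, on an existential window; it does not close item 22957 (the band line), not the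
typed-window rung `ColdDoublingRecursionStrongCoupling` (window `strongCouplingRadius r.ρ`), and it says nothing about weak coupling, the continuum,
or the Yang–Mills mass gap (Clay), which is NOT proved by anything in this file or this line.
-/

set_option autoImplicit false

noncomputable section

open Filter Topology Asymptotics MeasureTheory Finset
open Literature.Probability.LatticeModels
open Literature.MathematicalPhysics.QuantumFieldTheory
open Literature.MathematicalPhysics.QuantumFieldTheory.Balaban1983to89.Missing

namespace Summit.QuantumFields.YangMills.Theorems.GlueballBandRecursion.Thermal

/-! ## §1 From the full-kept lifting identity to the closed-kept density identity -/

section Bridge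

variable {G : Type*} [Group G] [TopologicalSpace G] [IsTopologicalGroup G] [CompactSpace G] [MeasurableSpace G] [BorelSpace G]
  {N : ℕ} (ρ : G →* Matrix (Fin N) (Fin N) ℂ)

open scoped Classical in
/-- In the box `b×b×b×T` (`b, T ≥ 2`), on the disc `‖z‖ ≤ r_ρ`: the FULL kept sum (singletons or closed-connected-small) is the singleton part
`6b³T·ℓ(z)` plus the closed kept sum. -/
theorem full_kept_eq_singletons_add (hρ : Continuous ρ) {b T : ℕ} (hb : 2 ≤ b) (hT : 2 ≤ T) (k : ℕ) {z : ℂ}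
    (hz : ‖z‖ ≤ strongCouplingRadius ρ) :
    (∑ A ∈ (Finset.univ : Finset (BoxLabel (![b, b, b, T] : Fin 4 → ℕ))).powerset with
        (A.card = 1 ∨ ((∀ p ∈ A, ∀ e ∈ p.bonds, ∃ q ∈ A, q ≠ p ∧ e ∈ q.bonds) ∧
          IsRConnected (boxSystem (G := G) ρ (![b, b, b, T] : Fin 4 → ℕ)).Adj A ∧ A.card ≤ k)),
        ∑ 𝒞 ∈ (rconnSubsets (boxSystem (G := G) ρ (![b, b, b, T] : Fin 4 → ℕ)).Adj A).powerset with 𝒞.biUnion id = A,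
          truncatedWeight (GeomInc (boxSystem (G := G) ρ (![b, b, b, T] : Fin 4 → ℕ)).Adj)
            (connActivity (boxSystem (G := G) ρ (![b, b, b, T] : Fin 4 → ℕ)).Adj (zdHaar 4 G)
              ((boxSystem (G := G) ρ (![b, b, b, T] : Fin 4 → ℕ)).weight z)) 𝒞) =
      ((b : ℂ) ^ 3 * T * 6) * Complex.log (∫ h, Complex.exp (-(z * (((N : ℝ) - (ρ h).trace.re : ℝ) : ℂ))) ∂haarProbability G) +
        ∑ A ∈ (Finset.univ : Finset (BoxLabel (![b, b, b, T] : Fin 4 → ℕ))).powerset with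
          ((∀ p ∈ A, ∀ e ∈ p.bonds, ∃ q ∈ A, q ≠ p ∧ e ∈ q.bonds) ∧
            IsRConnected (boxSystem (G := G) ρ (![b, b, b, T] : Fin 4 → ℕ)).Adj A ∧ A.card ≤ k),
          ∑ 𝒞 ∈ (rconnSubsets (boxSystem (G := G) ρ (![b, b, b, T] : Fin 4 → ℕ)).Adj A).powerset with 𝒞.biUnion id = A,
            truncatedWeight (GeomInc (boxSystem (G := G) ρ (![b, b, b, T] : Fin 4 → ℕ)).Adj)
              (connActivity (boxSystem (G := G) ρ (![b, b, b, T] : Fin 4 → ℕ)).Adj (zdHaar 4 G)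
                ((boxSystem (G := G) ρ (![b, b, b, T] : Fin 4 → ℕ)).weight z)) 𝒞 := by
  set nb : Fin 4 → ℕ := ![b, b, b, T] with hnb
  have hn : ∀ i, 1 < nb i := by
    intro i; fin_cases i <;> simp [hnb] <;> omega
  have hM := costBound_pos ρ
  obtain ⟨hzM, -, hz1⟩ := disc_hypotheses (D := boxDeg 4) hM (strongCouplingRadius_mul_costBound_le_one ρ)
    (strongCouplingRadius_smallness ρ) hz
  have hsing := Support.sum_support_card_eq_one (d := 4) (G := G) ρ hρ hn (r := ‖z‖) hzM hz1 Finset.univ (z := z) le_rfl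
  have hcard : ((Finset.univ : Finset (BoxLabel nb)).card : ℂ) = (b : ℂ) ^ 3 * T * 6 := by
    rw [Finset.card_univ, hnb, card_boxLabel_four]; push_cast; ring
  have hpq : ∀ A : Finset (BoxLabel nb), ¬(A.card = 1 ∧ ((∀ p ∈ A, ∀ e ∈ p.bonds, ∃ q ∈ A, q ≠ p ∧ e ∈ q.bonds) ∧
      IsRConnected (boxSystem (G := G) ρ nb).Adj A ∧ A.card ≤ k)) := by
    rintro A ⟨h1, h2⟩
    obtain ⟨p, rfl⟩ := Finset.card_eq_one.1 h1
    obtain ⟨e, he⟩ := (boxSystem (G := G) ρ nb).bonds_nonempty p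
    obtain ⟨q, hq, hqp, -⟩ := h2.1 p (Finset.mem_singleton_self p) e he
    exact hqp (Finset.mem_singleton.1 hq)
  rw [sum_filter_or_of_disjoint Finset.univ.powerset (fun A => A.card = 1)
    (fun A => (∀ p ∈ A, ∀ e ∈ p.bonds, ∃ q ∈ A, q ≠ p ∧ e ∈ q.bonds) ∧
      IsRConnected (boxSystem (G := G) ρ nb).Adj A ∧ A.card ≤ k) _ hpq, hsing, hcard]

open scoped Classical in
/-- **The closed-kept density identity** (the hypothesis `hlift` of the width seats' `norm_tubeLogZ_div_sub_le_of_kept_eq`, w4 g13) from the width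
seats' full-kept lifting identity (`SupportLifting.kept_sum_tube_mul_eq`, w5 g17): for `4 ≤ a ≤ a'`, `4 ≤ T` and `‖z‖ ≤ r_ρ`,
`K_{a'}(z)/a'³ = K_a(z)/a³` for the closed, connected supports with `≤ 4(a−1)` members (singletons contribute `6b³T·ℓ(z)`, proportional to `b³`). -/
theorem closed_kept_div_eq (hρ : Continuous ρ) {a a' T : ℕ} (ha : 4 ≤ a) (haa' : a ≤ a') (hT : 4 ≤ T) {z : ℂ}
    (hz : ‖z‖ ≤ strongCouplingRadius ρ) :
    (∑ A ∈ (Finset.univ : Finset (BoxLabel (![a', a', a', T] : Fin 4 → ℕ))).powerset with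
          ((∀ p ∈ A, ∀ e ∈ p.bonds, ∃ q ∈ A, q ≠ p ∧ e ∈ q.bonds) ∧
            IsRConnected (boxSystem (G := G) ρ (![a', a', a', T] : Fin 4 → ℕ)).Adj A ∧ A.card ≤ 4 * (a - 1)),
        ∑ 𝒞 ∈ (rconnSubsets (boxSystem (G := G) ρ (![a', a', a', T] : Fin 4 → ℕ)).Adj A).powerset with 𝒞.biUnion id = A,
          truncatedWeight (GeomInc (boxSystem (G := G) ρ (![a', a', a', T] : Fin 4 → ℕ)).Adj)
            (connActivity (boxSystem (G := G) ρ (![a', a', a', T] : Fin 4 → ℕ)).Adj (zdHaar 4 G)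
              ((boxSystem (G := G) ρ (![a', a', a', T] : Fin 4 → ℕ)).weight z)) 𝒞) / ((a' : ℂ) ^ 3) =
      (∑ A ∈ (Finset.univ : Finset (BoxLabel (![a, a, a, T] : Fin 4 → ℕ))).powerset with
          ((∀ p ∈ A, ∀ e ∈ p.bonds, ∃ q ∈ A, q ≠ p ∧ e ∈ q.bonds) ∧
            IsRConnected (boxSystem (G := G) ρ (![a, a, a, T] : Fin 4 → ℕ)).Adj A ∧ A.card ≤ 4 * (a - 1)),
        ∑ 𝒞 ∈ (rconnSubsets (boxSystem (G := G) ρ (![a, a, a, T] : Fin 4 → ℕ)).Adj A).powerset with 𝒞.biUnion id = A,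
          truncatedWeight (GeomInc (boxSystem (G := G) ρ (![a, a, a, T] : Fin 4 → ℕ)).Adj)
            (connActivity (boxSystem (G := G) ρ (![a, a, a, T] : Fin 4 → ℕ)).Adj (zdHaar 4 G)
              ((boxSystem (G := G) ρ (![a, a, a, T] : Fin 4 → ℕ)).weight z)) 𝒞) / ((a : ℂ) ^ 3) := by
  have hfull := SupportLifting.kept_sum_tube_mul_eq (G := G) (ρ := ρ) hρ ha haa' hT z
  rw [full_kept_eq_singletons_add ρ hρ (le_trans (by omega) haa') (by omega) (4 * (a - 1)) hz,
    full_kept_eq_singletons_add ρ hρ (by omega) (by omega) (4 * (a - 1)) hz] at hfull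
  have ha3 : ((a : ℂ) ^ 3) ≠ 0 := pow_ne_zero 3 (by exact_mod_cast (show a ≠ 0 by omega))
  have ha'3 : ((a' : ℂ) ^ 3) ≠ 0 := pow_ne_zero 3 (by exact_mod_cast (show a' ≠ 0 by omega))
  rw [div_eq_div_iff ha'3 ha3]
  linear_combination hfull

end Bridge

/-! ## §2 The jet stub, proved -/

section Jets

variable {G : Type*} [Group G] [TopologicalSpace G] [IsTopologicalGroup G] [CompactSpace G] [MeasurableSpace G] [BorelSpace G]
  {N : ℕ} (ρ : G →* Matrix (Fin N) (Fin N) ℂ)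

/-- **The explicit bound on the whole disc**: `‖coldVolumeDiscrepancy ρ a a' t z‖ ≤ 48t·(‖z‖/(e·r_ρ))^{4(a−1)+1}` for `4 ≤ a ≤ a'`, `4 ≤ t`,
`‖z‖ ≤ r_ρ` (the width seats' density bound at `T = t` and `T = 2t` with the lifted kept densities). -/
theorem norm_coldVolumeDiscrepancy_le_pow (hρ : Continuous ρ) {a a' t : ℕ} (ha : 4 ≤ a) (haa' : a ≤ a') (ht : 4 ≤ t) {z : ℂ}
    (hz : ‖z‖ ≤ strongCouplingRadius ρ) :
    ‖coldVolumeDiscrepancy ρ a a' t z‖ ≤ 48 * (t : ℝ) * (‖z‖ / (Real.exp 1 * strongCouplingRadius ρ)) ^ (4 * (a - 1) + 1) := by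
  have h1 := norm_tubeLogZ_div_sub_le_of_kept_eq ρ hρ (by omega) haa' (T := t) (by omega) hz
    (closed_kept_div_eq ρ hρ ha haa' ht hz)
  have h2 := norm_tubeLogZ_div_sub_le_of_kept_eq ρ hρ (by omega) haa' (T := 2 * t) (by omega) hz
    (closed_kept_div_eq ρ hρ ha haa' (T := 2 * t) (by omega) hz)
  have hid : coldVolumeDiscrepancy ρ a a' t z =
      2 * (tubeLogZ ρ a' t z / ((a' : ℂ) ^ 3) - tubeLogZ ρ a t z / ((a : ℂ) ^ 3)) -
        (tubeLogZ ρ a' (2 * t) z / ((a' : ℂ) ^ 3) - tubeLogZ ρ a (2 * t) z / ((a : ℂ) ^ 3)) := by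
    unfold coldVolumeDiscrepancy coldLogDefect; ring
  rw [hid]
  refine (norm_sub_le _ _).trans ?_
  rw [norm_mul, Complex.norm_ofNat]
  push_cast at h2
  nlinarith [h1, h2, norm_nonneg (tubeLogZ ρ a' t z / ((a' : ℂ) ^ 3) - tubeLogZ ρ a t z / ((a : ℂ) ^ 3))]

end Jets

/-- **`ColdFreeEnergyVolumeJets` — PROVED** (line 7b's stub #1, finite currency): for every compact `G`, faithful unitary `r`, `4 ≤ a ≤ a'`, `4 ≤ t`,
`coldVolumeDiscrepancy r.ρ a a' t =O[𝓝 0] z^{3a}` (indeed `O(z^{4a−3})`). -/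
theorem coldFreeEnergyVolumeJets_holds : ColdFreeEnergyVolumeJets := by
  intro G _ _ _ _
  letI : MeasurableSpace G := borel G
  haveI : BorelSpace G := ⟨rfl⟩
  intro r a b t ha hab ht
  have hr0 := strongCouplingRadius_pos r.ρ
  set C : ℝ := 48 * (t : ℝ) / (Real.exp 1 * strongCouplingRadius r.ρ) ^ (4 * (a - 1) + 1) with hC
  refine Asymptotics.IsBigO.of_bound C ?_
  have hnhds : ∀ᶠ z : ℂ in 𝓝 (0 : ℂ), ‖z‖ < min (strongCouplingRadius r.ρ) 1 := by
    have : Metric.ball (0 : ℂ) (min (strongCouplingRadius r.ρ) 1) ∈ 𝓝 (0 : ℂ) :=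
      Metric.ball_mem_nhds _ (lt_min hr0 one_pos)
    filter_upwards [this] with z hz
    rwa [Metric.mem_ball, dist_zero_right] at hz
  filter_upwards [hnhds] with z hz
  have hzr : ‖z‖ ≤ strongCouplingRadius r.ρ := hz.le.trans (min_le_left _ _)
  have hz1 : ‖z‖ ≤ 1 := hz.le.trans (min_le_right _ _)
  refine (norm_coldVolumeDiscrepancy_le_pow r.ρ r.continuous ha hab ht hzr).trans ?_
  rw [norm_pow, div_pow, hC]
  have hpow : ‖z‖ ^ (4 * (a - 1) + 1) ≤ ‖z‖ ^ (3 * a) := pow_le_pow_of_le_one (norm_nonneg z) hz1 (by omega)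
  have hre : 48 * (t : ℝ) * (‖z‖ ^ (4 * (a - 1) + 1) / (Real.exp 1 * strongCouplingRadius r.ρ) ^ (4 * (a - 1) + 1)) =
      (48 * (t : ℝ) / (Real.exp 1 * strongCouplingRadius r.ρ) ^ (4 * (a - 1) + 1)) * ‖z‖ ^ (4 * (a - 1) + 1) := by ring
  rw [hre]
  exact mul_le_mul_of_nonneg_left hpow (by positivity)

/-! ## §3 The volume comparison and the ∃-window rung — PROVED -/

/-- **`TraceExcessVolumeComparisonSmallCoupling` — PROVED**: for every compact `G` and faithful unitary `r` there are `β₁ > 0`, `K`, `L₀` with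
`x_{⌊L/4⌋}(L') ≤ K·x_{⌊L/4⌋}(L)` for all `0 ≤ β ≤ β₁`, `L ≥ L₀`, `L' ∈ [2L, 4L]` — the cold thermal trace excess is extensive in the spatial volume
at small coupling. -/
theorem traceExcessVolumeComparisonSmallCoupling_holds : TraceExcessVolumeComparisonSmallCoupling :=
  traceExcessVolumeComparisonSmallCoupling_of_coldJets coldFreeEnergyVolumeJets_holds traceExcessFloorAllSides_holds

/-- **THE ∃-WINDOW STRONG-COUPLING RUNG — PROVED: `ColdDoublingRecursionSmallCoupling`.**  For every compact group `G` and faithful unitary lattice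
representation `r` there are `β₁ > 0`, `C > 0`, `L₀` such that `coldDefect r.ρ β L' ≤ C · (coldDefect r.ρ β L)²` for all `0 ≤ β ≤ β₁`, `L ≥ L₀`,
`2L ≤ L' ≤ 4L`.  Line 7b of route `GlueballBandRecursion` (LEAD `ym-line-cbag-p1` + width seats w2–w5): same-volume squaring + volume comparison +
closedness-aware support expansion of the strong-coupling cluster expansion.  RECORD-type; the typed-window rung (`strongCouplingRadius r.ρ`) and the
Yang–Mills mass gap are NOT claimed. -/
theorem coldDoublingRecursionSmallCoupling_holds : ColdDoublingRecursionSmallCoupling :=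
  coldDoublingRecursionSmallCoupling_of_coldJets coldFreeEnergyVolumeJets_holds traceExcessFloorAllSides_holds

end Summit.QuantumFields.YangMills.Theorems.GlueballBandRecursion.Thermal

end
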